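import Literature.MathematicalPhysics.QuantumFieldTheory.Balaban1983to89.T4MatchingClosureSocket

/-!
# `T4Continuum.Support.WeightRouteEnd` — node U5 (NE7), road P3-W «weight route»: the closure END on the
DESIGN-AGNOSTIC weight socket with the remnant clause named, and the typed leaf shapes of the OLD remnant side

(cell `pub-balaban`, BINDER-OWNERS row NE7 co-owner #3 `b2b-balaban-t4-ne7-p3`, ROUND-2 skeleton
`t4/skeletons/NE7-t4-ne7-p3.md`; kernel bookkeeping only.)

HONEST FRAMING (T4-DAG PAGE 1).  The cell's T⁴ target is the existence AND uniqueness of the `ε → 0` limit of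
unit-scale averaged gauge-invariant expectations on a FIXED finite torus (rung (B)+1), CONDITIONAL on BetaPertH and the
nine spine estimates (0/9 proved); NOT infinite volume, NOT the mass gap, NOT the Clay problem.  This module proves NO
estimate: §1 is one application of the landed seam (ζ′) `T4MatchingClosureSocket.hybridNE7_closure'_tail` with the
remnant rates of `T4MatchingClosureRem` inside the term-wise budget; §2 types, as `Prop`-valued definitions over
ABSTRACT carriers, the four elementary steps (S3)–(S6) by which the cell record `t4/T4-EST-U5E-rem.md` §3 derives the
OLD half of NE7b-rem from a banked re-run of [Balaban1989LargeFieldII] (1.79)–(1.98), and proves those that are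
elementary real analysis (S3a/S3b, S4 in Finset and `Fin q` form, the composition shape).  Nothing of Bałaban's is asserted or instantiated; every estimate is a BINDER.
HONEST DEPENDENCY: continuum YM on T⁴ ⇐ BetaPertH ∧ nine spine estimates (0/9 proved); BetaPertH ⇐ (D1) ∧ (D4) ∧
CAP+tail; G-an2-4 gates asym, D1 and NE2/3/4.

v1.2 (same seat, APPEND-ONLY — every v1.1 declaration byte-identical): §3 adds the PROFILE-PINNED form
`MarkedExponentiationBoundAt locR pr profile c` of leaf S5's shape.  The v1.1 shape `MarkedExponentiationBound` quantifies
over ALL activity profiles `pr` inside and is therefore TOO STRONG as a model of the record's S5 (the cluster-expansion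
series is Lipschitz in its activities only on the Kotecký–Preiss region of ONE given profile `F̄`; with `pr` free the
shape is inhabited essentially only by `w`-independent `locR`) — a typing slip of this seat, found while writing the
non-vacuity witness, NOT a statement about Bałaban.  The pinned form is the one the swarm stub (s3) is to PROVE over the
KP layer and the one `Support/RemnantOldComposition.lean` v1.1 consumes; the strong form implies it
(`markedExponentiationBoundAt_of_strong`) and is kept only for append-only hygiene.  §3 also gives the pinned form's
elementary inhabitant (`markedExponentiationBoundAt_eval`: evaluation at one polymer per domain, modulus 2).
-/

open Finset

namespace Summit.QuantumFields.BalabanUV.T4Continuum.WeightRoute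

open Literature.MathematicalPhysics.QuantumFieldTheory.Balaban1983to89
open Literature.MathematicalPhysics.QuantumFieldTheory.Balaban1983to89.T4WeightBudget
open Literature.MathematicalPhysics.QuantumFieldTheory.Balaban1983to89.T4IndicatorShell
open Literature.MathematicalPhysics.QuantumFieldTheory.Balaban1983to89.T4GoodClassBudget
open Literature.MathematicalPhysics.QuantumFieldTheory.Balaban1983to89.T4MatchingAssembly
open Literature.MathematicalPhysics.QuantumFieldTheory.Balaban1983to89.T4MatchingClosure
open Literature.MathematicalPhysics.QuantumFieldTheory.Balaban1983to89.T4RemnantBooking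
open Literature.MathematicalPhysics.QuantumFieldTheory.Balaban1983to89.T4MatchingClosureRem
open Literature.MathematicalPhysics.QuantumFieldTheory.Balaban1983to89.T4MatchingClosureSocket

/-! ## §1 The END of road P3-W: seam (ζ′) ⊕ NE7b-rem, weight socket design-agnostic -/

section End

variable {ι : Type*} [DecidableEq ι] {l₀ vol : ℝ} {T : ℕ → Finset ι} {A B shA shB : ℕ → ℝ → ι → ℝ}
  {Bad : ℕ → ℝ → Finset ι} {Cc Rr CcRec RrRec : ℕ → ℝ → ι → ℝ} {ν u' s₂ c₀ r' s W Wsh : ℕ → ℝ}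
  {remOld : ℕ → ℕ → ℝ} {Λ C C' E₀ ρ θ Cy : ℝ} {Wy : ℕ → ℕ}

/-- **ROAD P3-W END (node U5 on the design-agnostic weight socket, remnant clause named).**  ANY NE7b datum in output
shape `RelWeightBound … W` (the count road's `CountThresholdUniform.relWeightBoundZ_of_irThreshold`, a global-denominator
exit `T4GlobalDenominator.relWeightBound_of_globalDom`, or `T4MatchingClosure.relWeightBound_of_slotDom_log`), ANY NE7c
datum `ShellWeightBound … shA shB Wsh`, the OLD remnant clause `RemnantAgeBound remOld E₀ ρ` with its window arithmetic
`⌈C log Λ⌉₊ + 3 ≤ C′(−log ρ)`, a sub-linear YOUNG allowance `Wy` (Lemma Y), and the term-wise budget on the hybrid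
cores with the two remnant rates inside (`ReindexedBudget`, road P1's half + the young two-run rate) with summable
producer rates `r′ u′ s s₂` ⇒ the `K₀`-shifted families carry a `HybridNE7` datum for some `K₀`.  One application of
`hybridNE7_closure'_tail`; CONDITIONAL on every binder; nothing PRINTED is asserted. [folklore] -/
theorem hybridNE7_closure'_tail_remnantW (hW : RelWeightBound l₀ T A B Bad W)
    (hSh : ShellWeightBound l₀ T A B shA shB Wsh)
    (hRem : RemnantAgeBound remOld E₀ ρ) (hΛ : 1 ≤ Λ) (hC : 0 ≤ C) (hE : 0 ≤ E₀) (hρ0 : 0 < ρ) (hρ1 : ρ < 1)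
    (hq : ((⌈C * Real.log Λ⌉₊ : ℕ) : ℝ) + 3 ≤ C' * (-Real.log ρ)) (hθ : 0 < θ) (hθ1 : θ < 1)
    (hWy : SublinearWindow Wy)
    (hTB : ReindexedBudget l₀ vol T (fun K t τ => A K t τ - shA K t τ) (fun K t τ => B K t τ - shB K t τ) Bad Cc Rr
      CcRec RrRec ν (fun K => u' K + remnantOld remOld Λ C C' K) s₂ c₀
      (fun K => r' K + Cy * remnantYoungW θ Λ C Wy K) s)
    (hr : Summable r') (hu : Summable u') (hs : Summable s) (hs₂ : Summable s₂) :
    ∃ K₀, HybridNE7 l₀ vol (fun K => T (K₀ + K)) (fun K => A (K₀ + K)) (fun K => B (K₀ + K)) (fun K => Bad (K₀ + K))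
      (fun K => W (K₀ + K)) (fun K => shA (K₀ + K)) (fun K => shB (K₀ + K)) (fun K => Wsh (K₀ + K))
      (fun K => ((r' (K₀ + K) + Cy * remnantYoungW θ Λ C Wy (K₀ + K)) +
          (u' (K₀ + K) + remnantOld remOld Λ C C' (K₀ + K))) + (s (K₀ + K) + s₂ (K₀ + K))) :=
  hybridNE7_closure'_tail hW hSh hTB (summable_add_remnantYoungW hr hθ hθ1 hΛ hC hWy)
    (summable_add_remnantOld hu hΛ hC hE hρ0 hρ1 hRem hq) hs hs₂

end End

/-! ## §2 The OLD remnant side (NE7b-rem (a)), typed on abstract carriers: leaves S3–S6 of the skeleton -/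

section OldSide

/-- LEAF S3a (print's ENTROPY DEVICE, [Balaban1989LargeFieldII] p. 383 «the summations over the admissible sequences
can be replaced by the factors exp O(1)(MR_j)^{−d}|Z_j|», as an abstract inequality): if the reciprocal count factors
of a finite family sum to at most one, the SUM of nonnegative weights is at most the SUP of weight × count factor —
here in the form «every weight × count ≤ M ⇒ Σ ≤ M», which is what (1.79)/(1.89) use.  HYPOTHESIS-FREE real analysis.
[folklore] -/
theorem sum_le_of_mul_cnt_le {H : Type*} (s : Finset H) {w cnt : H → ℝ} {M : ℝ} (hM : 0 ≤ M)
    (hcnt : ∀ h ∈ s, 0 < cnt h) (hdev : ∑ h ∈ s, (cnt h)⁻¹ ≤ 1) (hw : ∀ h ∈ s, w h * cnt h ≤ M) :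
    ∑ h ∈ s, w h ≤ M := by
  calc ∑ h ∈ s, w h = ∑ h ∈ s, (w h * cnt h) * (cnt h)⁻¹ := by
        refine Finset.sum_congr rfl fun h hh => ?_
        rw [mul_assoc, mul_inv_cancel₀ (hcnt h hh).ne', mul_one]
    _ ≤ ∑ h ∈ s, M * (cnt h)⁻¹ :=
        Finset.sum_le_sum fun h hh => mul_le_mul_of_nonneg_right (hw h hh) (inv_nonneg.mpr (hcnt h hh).le)
    _ = M * ∑ h ∈ s, (cnt h)⁻¹ := by rw [Finset.mul_sum]
    _ ≤ M * 1 := mul_le_mul_of_nonneg_left hdev hM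
    _ = M := mul_one M

/-- LEAF S3b (RESTRICTION TO THE OLD-BANK SUB-FAMILY; record §3 S3): if along every sub-history `h` the banked
induction (leaf S1 = `T4BankedInduction.banked_induction`, the cell's re-run of (1.80)–(1.88)) gives
`w h · cnt h ≤ e^{−bank h} · M₀`, then the sub-sum over the sub-histories with `bank h ≥ Bk` is at most `e^{−Bk} · M₀`
(the marked mass `𝐓′_{k,≥B} 1 ≤ e^{−B}·exp(−2(1+β₀)^{−1}p₀(g_k))` of the record).  HYPOTHESIS-FREE real analysis on
abstract data. [folklore] -/
theorem sum_filter_bank_le {H : Type*} (s : Finset H) {w cnt bank : H → ℝ} {M₀ Bk : ℝ} (hM : 0 ≤ M₀)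
    (hcnt : ∀ h ∈ s, 0 < cnt h) (hdev : ∑ h ∈ s, (cnt h)⁻¹ ≤ 1)
    (hbank : ∀ h ∈ s, w h * cnt h ≤ Real.exp (-bank h) * M₀) :
    ∑ h ∈ s with Bk ≤ bank h, w h ≤ Real.exp (-Bk) * M₀ := by
  have hsub : (s.filter fun h => Bk ≤ bank h) ⊆ s := Finset.filter_subset _ _
  refine sum_le_of_mul_cnt_le _ (mul_nonneg (Real.exp_pos _).le hM) (fun h hh => hcnt h (hsub hh)) ?_ ?_
  · exact (Finset.sum_le_sum_of_subset_of_nonneg hsub fun h hh _ => inv_nonneg.mpr (hcnt h hh).le).trans hdev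
  · intro h hh
    have hb : Bk ≤ bank h := (Finset.mem_filter.mp hh).2
    exact (hbank h (hsub hh)).trans
      (mul_le_mul_of_nonneg_right (Real.exp_le_exp.mpr (by linarith)) hM)

/-- LEAF S4, Finset form (MARKED ACTIVITY, record §3 S4): an activity is a product over slots of operator masses
`lo i + hi i` (unmarked + marked part, both nonnegative); the MARKED part of the product — `∏ (lo + hi) − ∏ lo` — is at
most `Σ_i hi i · ∏_{i' ≠ i} (lo i' + hi i')` (the multilinearity of [Balaban1989LargeFieldII] (1.91) p. 388 in its `q`
operator slots, as an abstract inequality).  Proof: induction on the slot set.  HYPOTHESIS-FREE real analysis.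
[folklore] -/
theorem prod_add_sub_prod_le {κ : Type*} [DecidableEq κ] (s : Finset κ) {lo hi : κ → ℝ}
    (hlo : ∀ i ∈ s, 0 ≤ lo i) (hhi : ∀ i ∈ s, 0 ≤ hi i) :
    ∏ i ∈ s, (lo i + hi i) - ∏ i ∈ s, lo i ≤ ∑ i ∈ s, hi i * ∏ i' ∈ s.erase i, (lo i' + hi i') := by
  induction s using Finset.induction_on with
  | empty => simp
  | @insert a s ha ih =>
    have hlo' : ∀ i ∈ s, 0 ≤ lo i := fun i hi' => hlo i (mem_insert_of_mem hi')
    have hhi' : ∀ i ∈ s, 0 ≤ hi i := fun i hi' => hhi i (mem_insert_of_mem hi')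
    have hla : 0 ≤ lo a := hlo a (mem_insert_self a s)
    have hha : 0 ≤ hi a := hhi a (mem_insert_self a s)
    have hP : 0 ≤ ∏ i ∈ s, (lo i + hi i) := prod_nonneg fun i hi' => add_nonneg (hlo' i hi') (hhi' i hi')
    have ih' := ih hlo' hhi'
    rw [prod_insert ha, prod_insert ha, sum_insert ha, erase_insert ha]
    have hrew : ∑ i ∈ s, hi i * ∏ i' ∈ (insert a s).erase i, (lo i' + hi i') =
        (lo a + hi a) * ∑ i ∈ s, hi i * ∏ i' ∈ s.erase i, (lo i' + hi i') := by
      rw [mul_sum]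
      refine sum_congr rfl fun i hi' => ?_
      have hne : a ≠ i := fun h => ha (h ▸ hi')
      rw [erase_insert_of_ne hne, prod_insert (fun h => ha (mem_of_mem_erase h))]
      ring
    rw [hrew]
    have h1 : (lo a + hi a) * ∏ i ∈ s, (lo i + hi i) - lo a * ∏ i ∈ s, lo i
        = lo a * (∏ i ∈ s, (lo i + hi i) - ∏ i ∈ s, lo i) + hi a * ∏ i ∈ s, (lo i + hi i) := by ring
    rw [h1]
    have h2 : lo a * (∏ i ∈ s, (lo i + hi i) - ∏ i ∈ s, lo i) ≤
        (lo a + hi a) * ∑ i ∈ s, hi i * ∏ i' ∈ s.erase i, (lo i' + hi i') := by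
      have hS : 0 ≤ ∑ i ∈ s, hi i * ∏ i' ∈ s.erase i, (lo i' + hi i') :=
        sum_nonneg fun i hi' => mul_nonneg (hhi' i hi')
          (prod_nonneg fun i' hi'' => add_nonneg (hlo' i' (mem_of_mem_erase hi'')) (hhi' i' (mem_of_mem_erase hi'')))
      calc lo a * (∏ i ∈ s, (lo i + hi i) - ∏ i ∈ s, lo i)
          ≤ lo a * ∑ i ∈ s, hi i * ∏ i' ∈ s.erase i, (lo i' + hi i') := mul_le_mul_of_nonneg_left ih' hla
        _ ≤ (lo a + hi a) * ∑ i ∈ s, hi i * ∏ i' ∈ s.erase i, (lo i' + hi i') :=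
            mul_le_mul_of_nonneg_right (by linarith) hS
    linarith

/-- LEAF S4, quantitative form: marked slots `hi i ≤ e^{−Bk}·M`, all slots `lo i + hi i ≤ M` (`M ≥ 0`) ⇒ the marked
product is at most `#s · e^{−Bk} · M^{#s}` — the factor `q` of the record's `|F_{≥B}| ≤ e^{−B}·Σ_q q·[q-summand]`,
absorbed downstream in (1.96) at the price `p₀ ↦ p₀ − 2 log 2`.  HYPOTHESIS-FREE real analysis. [folklore] -/
theorem prod_add_sub_prod_le_card_mul {κ : Type*} [DecidableEq κ] (s : Finset κ) {lo hi : κ → ℝ} {M Bk : ℝ}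
    (hM : 0 ≤ M) (hlo : ∀ i ∈ s, 0 ≤ lo i) (hhi : ∀ i ∈ s, 0 ≤ hi i)
    (hmark : ∀ i ∈ s, hi i ≤ Real.exp (-Bk) * M) (hall : ∀ i ∈ s, lo i + hi i ≤ M) :
    ∏ i ∈ s, (lo i + hi i) - ∏ i ∈ s, lo i ≤ s.card * (Real.exp (-Bk) * M ^ s.card) := by
  refine (prod_add_sub_prod_le s hlo hhi).trans ?_
  have hterm : ∀ i ∈ s, hi i * ∏ i' ∈ s.erase i, (lo i' + hi i') ≤ Real.exp (-Bk) * M ^ s.card := by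
    intro i hi'
    have hprod : ∏ i' ∈ s.erase i, (lo i' + hi i') ≤ M ^ (s.card - 1) := by
      calc ∏ i' ∈ s.erase i, (lo i' + hi i') ≤ ∏ i' ∈ s.erase i, M :=
            prod_le_prod (fun i' hi'' => add_nonneg (hlo i' (mem_of_mem_erase hi'')) (hhi i' (mem_of_mem_erase hi'')))
              (fun i' hi'' => hall i' (mem_of_mem_erase hi''))
        _ = M ^ (s.card - 1) := by rw [prod_const, card_erase_of_mem hi']
    have hP0 : 0 ≤ ∏ i' ∈ s.erase i, (lo i' + hi i') :=
      prod_nonneg fun i' hi'' => add_nonneg (hlo i' (mem_of_mem_erase hi'')) (hhi i' (mem_of_mem_erase hi''))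
    have hcard : 1 ≤ s.card := Finset.one_le_card.mpr ⟨i, hi'⟩
    calc hi i * ∏ i' ∈ s.erase i, (lo i' + hi i')
        ≤ (Real.exp (-Bk) * M) * M ^ (s.card - 1) :=
          mul_le_mul (hmark i hi') hprod hP0 (mul_nonneg (Real.exp_pos _).le hM)
      _ = Real.exp (-Bk) * M ^ s.card := by
          rw [mul_assoc, ← pow_succ', Nat.sub_add_cancel hcard]
  calc ∑ i ∈ s, hi i * ∏ i' ∈ s.erase i, (lo i' + hi i')
      ≤ ∑ i ∈ s, Real.exp (-Bk) * M ^ s.card := sum_le_sum hterm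
    _ = s.card * (Real.exp (-Bk) * M ^ s.card) := by rw [sum_const, nsmul_eq_mul]

/-- LEAF S4 as the skeleton names it (`Fin q` slots): the statement `MarkedProductBound q`. (a definition; PROVED below
for every `q` — kept as a named shape because the skeleton's leaf list refers to it) [folklore] -/
def MarkedProductBound (q : ℕ) : Prop :=
  ∀ (lo hi : Fin q → ℝ), (∀ i, 0 ≤ lo i) → (∀ i, 0 ≤ hi i) →
    ∏ i, (lo i + hi i) - ∏ i, lo i ≤ ∑ i, hi i * ∏ i' ∈ Finset.univ.erase i, (lo i' + hi i')

/-- LEAF S4 DISCHARGED: `MarkedProductBound q` holds for every `q` (from the Finset form). [folklore] -/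
theorem markedProductBound (q : ℕ) : MarkedProductBound q := fun _ _ hlo hhi =>
  prod_add_sub_prod_le Finset.univ (fun i _ => hlo i) (fun i _ => hhi i)

/-- LEAF S5 (MARKED EXPONENTIATION, record §3 S5; HYPOTHESIS SHAPE): for a Kotecký–Preiss polymer system with two
activity families `wF` (all sub-histories) and `wL` (old-bank sub-histories switched off) obeying the SAME decay
profile and `|wF − wL| ≤ 2e^{−Bk}·profile`, the ANCHORED difference of the localized log-partition pieces is at most
`c · e^{−Bk} · (anchored profile sum)`.  The kernel siblings in KP form are
`Literature.Probability.LatticeModels.PolymerLogZLipschitz.norm_polymerLogZ_sub_polymerLogZ_le` (global) and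
`…TruncatedWeightLipschitz.sum_filter_norm_truncatedWeight_sub_le_exp_neg_mul` (anchored, decaying sub-families); the
identification of [Balaban1989LargeFieldII] (1.98)'s localization with the tree's truncated weights is the cell's
READING (GAPS C-pv14-29 / G-B16-09), not print.  Typed abstractly: a Lipschitz modulus `c` of an `X`-indexed family
of functions of the activities. (a definition; the bound is a swarm leaf over the KP layer) [folklore] -/
def MarkedExponentiationBound {X P : Type*} (locR : (P → ℝ) → X → ℝ) (profile : X → ℝ) (c : ℝ) : Prop :=
  ∀ (wF wL : P → ℝ) (pr : P → ℝ) (Bk : ℝ), 0 ≤ Bk →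
    (∀ p, |wF p| ≤ pr p) → (∀ p, |wL p| ≤ pr p) → (∀ p, |wF p - wL p| ≤ 2 * Real.exp (-Bk) * pr p) →
    ∀ x, |locR wF x - locR wL x| ≤ c * Real.exp (-Bk) * profile x

/-- LEAF S6 (ANCHORED COUNT, printed TYPE «in the usual way», [Balaban1989LargeFieldII] (1.94)/(1.96) p. 389;
HYPOTHESIS SHAPE): the localization domains through a fixed cube, weighted by tree decay `e^{−κ d(X)}`, sum to at most
`Cκ` — a lattice-animal count ([geom]; tree siblings `B16Exp198.kp_condition_rel`, `T4PinnedGasOfGeometry`).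
(a definition) [folklore] -/
def AnchoredCount {X Q : Type*} (through : Q → Finset X) (dk : X → ℝ) (κ Cκ : ℝ) : Prop :=
  ∀ q, ∑ x ∈ through q, Real.exp (-(κ * dk x)) ≤ Cκ

/-- COMPOSITION SHAPE of the OLD side (record §3: S1 + S3–S6 ⇒ §0 (b)): per scale-`j` cube, the old-bank part of the
remnant family obeys `remOld j Ak ≤ E₀ · ρ^Ak` for ALL `Ak`, i.e. literally `T4RemnantBooking.RemnantAgeBound remOld E₀ ρ`
with `ρ = e^{−c_e p̄₀}`, `E₀ = 8·O(1)·Cκ·e^{−p̄₀}` — the binder `hRem` of §1 / the clauses `hsizeA`, `hsizeB` of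
`T4MatchingClosureSocket.hybridNE7_closure_socket_records`.  Recorded here as the target statement of the OLD-side
swarm (leaves S1, S3a/b, S4, S5, S6); nothing printed is asserted. [folklore] -/
theorem remnantAgeBound_of_exp {remOld : ℕ → ℕ → ℝ} {E₀ ce p₀ : ℝ}
    (h0 : ∀ j Ak, 0 ≤ remOld j Ak) (h : ∀ j Ak, remOld j Ak ≤ E₀ * Real.exp (-(ce * p₀ * Ak))) :
    RemnantAgeBound remOld E₀ (Real.exp (-(ce * p₀))) := by
  intro j Ak
  refine ⟨h0 j Ak, ?_⟩
  have : Real.exp (-(ce * p₀ * Ak)) = Real.exp (-(ce * p₀)) ^ Ak := by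
    rw [← Real.exp_nat_mul]; ring_nf
  rw [← this]
  exact h j Ak

end OldSide

/-! ## §3 (v1.2) Leaf S5's shape with the activity profile PINNED -/

section Pinned

/-- LEAF S5, PROFILE-PINNED (record §3 S5; HYPOTHESIS SHAPE, supersedes the too-strong v1.1 `MarkedExponentiationBound`
for all uses): for ONE given activity profile `pr` (the KP-small majorant `F̄ = c₁e^{−(1+β)κd}` of
[Balaban1989LargeFieldII] (1.97) p. 389 in the intended reading — a locator, not an assertion), two activity families
below the profile whose difference is `≤ 2e^{−Bk}·pr` have localized exponentiated pieces differing by at most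
`c·e^{−Bk}·profile`.  To be PROVED over the tree's Kotecký–Preiss layer (swarm stub (s3):
`TruncatedWeightLipschitz.sum_filter_norm_truncatedWeight_sub_le_exp_neg_mul`); nothing printed is asserted.
(a definition) [folklore] -/
def MarkedExponentiationBoundAt {X P : Type*} (locR : (P → ℝ) → X → ℝ) (pr : P → ℝ) (profile : X → ℝ) (c : ℝ) :
    Prop :=
  ∀ (wF wL : P → ℝ) (Bk : ℝ), 0 ≤ Bk →
    (∀ p, |wF p| ≤ pr p) → (∀ p, |wL p| ≤ pr p) → (∀ p, |wF p - wL p| ≤ 2 * Real.exp (-Bk) * pr p) →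
    ∀ x, |locR wF x - locR wL x| ≤ c * Real.exp (-Bk) * profile x

/-- The v1.1 (profile-free) shape implies the pinned one at every profile. [folklore] -/
theorem markedExponentiationBoundAt_of_strong {X P : Type*} {locR : (P → ℝ) → X → ℝ} {profile : X → ℝ} {c : ℝ}
    (h : MarkedExponentiationBound locR profile c) (pr : P → ℝ) : MarkedExponentiationBoundAt locR pr profile c :=
  fun wF wL Bk hBk hF hL hd x => h wF wL pr Bk hBk hF hL hd x

/-- NON-VACUITY of the pinned shape (elementary inhabitant): evaluation at one polymer per domain, `locR w x = w (π x)`,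
satisfies `MarkedExponentiationBoundAt` with modulus `2` whenever the profile dominates the activity profile along `π`.
(The intended inhabitant is the cluster-expansion series — stub (s3); this one only certifies the binder is
satisfiable together with a non-trivial difference `wF ≠ wL`.) [folklore] -/
theorem markedExponentiationBoundAt_eval {X P : Type*} (π : X → P) {pr : P → ℝ} {profile : X → ℝ}
    (hdom : ∀ x, pr (π x) ≤ profile x) :
    MarkedExponentiationBoundAt (fun w x => w (π x)) pr profile 2 := by
  intro wF wL Bk _ _ _ hd x
  calc |wF (π x) - wL (π x)| ≤ 2 * Real.exp (-Bk) * pr (π x) := hd (π x)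
    _ ≤ 2 * Real.exp (-Bk) * profile x :=
        mul_le_mul_of_nonneg_left (hdom x) (mul_nonneg (by norm_num) (Real.exp_pos _).le)

end Pinned

end Summit.QuantumFields.BalabanUV.T4Continuum.WeightRoute
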